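import Mathlib
import Summits.Ventures.PercRepro2.HCov
import Summits.Ventures.PercRepro2.RECMReduction
import Summits.Ventures.PercRepro2.GcSkelRules
import Summits.Ventures.PercRepro2.GcSkelReductionI
import Summits.Ventures.PercRepro2.GcSkelTwoConnected
import Summits.Ventures.PercRepro2.GcBlockConn
import Summits.Ventures.PercRepro2.GcBlock
import Summits.Ventures.PercRepro2.GcSkelReductionT
import Summits.Ventures.PercRepro2.GcSkelReductionTW

/-!
# The shape of the residual, in one statement (blind cell PercRepro2, typer-1 g54)

**`shape_of_wredT`** conjoins what the reduction lane knows about an instance of the residual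
`WReducedT` with five distinct marks — the class on which the crux `HCov_all` lives
(`HCov_all_iff_HCovWRedT_all`):

1. the graph is simple;
2. every unmarked vertex has non-loop degree `0` or `≥ 3`;
3. none of `o, b, a₁, a₂` is a leaf (the only pendant mark is `a₃`, at an unmarked vertex of
   non-loop degree `≥ 3`: `g1_leaf_shape`);
4. the graph is two-connected off `a₃`: for every vertex `v`, two non-isolated vertices other than
   `v` and `a₃` are connected in `G − v` (g53's `conn_sepConfig_of_wredI`);
5. the unmarked vertices are three-connected to the marks: for every two vertices `u, v`, every
   unmarked vertex `y ∉ {u, v}` of positive non-loop degree reaches a mark in `G − {u, v}`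
   (`MarksReach`, from the block collapse);
6. every mark-free two-terminal block consists of isolated vertices (`block_isolated_of_wredT`).

Nothing here is new beyond its parts; it is the statement of record of the residual's shape.
-/

namespace Summit.Ventures.PercRepro2

open CovForm RECM SepPair

namespace WRed

section Shape

variable {V : Type*} {E : Type*} [Fintype E] [DecidableEq E] [DecidableEq V]

/-- **THE SHAPE OF THE RESIDUAL**: an instance of `WReducedT` with five distinct marks is simple,
its unmarked vertices have non-loop degree `0` or `≥ 3`, none of `o, b, a₁, a₂` is a leaf, it is
two-connected off `a₃`, its unmarked vertices reach the marks past any two vertices, and its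
mark-free two-terminal blocks are isolated vertices. -/
theorem shape_of_wredT {ends : E → Sym2 V} {o a₁ a₂ a₃ b : V} (h : WReducedT ends o a₁ a₂ a₃ b)
    (h12 : a₁ ≠ a₂) (h13 : a₁ ≠ a₃) (h23 : a₂ ≠ a₃) (ho1 : o ≠ a₁) (ho2 : o ≠ a₂) (ho3 : o ≠ a₃)
    (hob : o ≠ b) (hb1 : b ≠ a₁) (hb2 : b ≠ a₂) (hb3 : b ≠ a₃) :
    Simple ends ∧
    (∀ y, Unmarked o a₁ a₂ a₃ b y → nonLoopDeg ends y = 0 ∨ 3 ≤ nonLoopDeg ends y) ∧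
    (nonLoopDeg ends o ≠ 1 ∧ nonLoopDeg ends b ≠ 1 ∧ nonLoopDeg ends a₁ ≠ 1 ∧
      nonLoopDeg ends a₂ ≠ 1) ∧
    (∀ v x y : V, x ≠ v → y ≠ v → x ≠ a₃ → y ≠ a₃ → (∃ e, x ∈ ends e ∧ ¬ (ends e).IsDiag) →
      (∃ e, y ∈ ends e ∧ ¬ (ends e).IsDiag) → Conn ends (sepConfig ends {v}) x y) ∧
    MarksReach ends o a₁ a₂ a₃ b ∧
    (∀ (W : Set V) (u v : V), Block.IsBlock ends W u v → (∀ y ∈ W, Unmarked o a₁ a₂ a₃ b y) →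
      ∀ y ∈ W, nonLoopDeg ends y = 0) := by
  refine ⟨h.simple, fun y hy => ?_, ⟨h.deg_o, h.deg_b, h.deg_a1, h.deg_a2⟩,
    fun v x y hxv hyv hx3 hy3 hx hy => ?_, marksReach_of_wredT h,
    fun W u v hB hW y hy => block_isolated_of_wredT h hB hW hy⟩
  · obtain ⟨h1, h2⟩ := h.unmarked y hy
    omega
  · exact conn_sepConfig_of_wredI h.toWReducedI h12 h13 h23 ho1 ho2 ho3 hob hb1 hb2 hb3 hxv hyv
      hx3 hy3 hx hy

end Shape

end WRed

end Summit.Ventures.PercRepro2
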